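import Literature.AnabelianGeometry.AbsoluteAnabelian.AbsTopIII.FrobeniusPictureMLFCompatibility

/-!
# [AbsTopIII] Cor 3.6 (iii): paths of `𝒟` ending in the first three rows lift uniquely to `𝒟_{≤3}`
# (combinatorics of the embedding `embLog : 𝒟_{≤3} ↪ 𝒟`)

S. Mochizuki, *Topics in Absolute Anabelian Geometry III*, Cor. 3.6 pp. 78–80 of the kurims manuscript
(`paper:url-5493eb38cbb7`; bib key `MochizukiAbsTopIII2015`); proof of (iii) p. 81 (the boundary set
`E_log` consists of pairs of paths "on `Γ⃗_{𝒟_{≤3}}` [i.e., the underlying oriented graph of `𝒟_{≤3}`]").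
Seat abc-iut-L4-t5 (gen 4); bookkeeping for the discharge of the literal compatibility statement
`LogObsCompatCoresStmt` (blueprint `HOME/staging/L4/L4-t5/DISCHARGE-PLAN-Cor36-compat.md`): along the
edges of `Γ⃗_𝒟` the row index never decreases (`LFVertex.row_le_of_hom`), so a path of `𝒟` ending at a
vertex of rows 1–3 runs inside `𝒟_{≤3}` and LIFTS along `embLog` (`liftLogVertex`, `liftLogEdge`,
`liftLogPath`), the lift being a two-sided inverse of `embLog.mapPath` (`embLog_mapPath_liftLogPath`,
`liftLogPath_mapPath`).  Pure combinatorics; no claim of the paper is asserted.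
-/

namespace Literature.AnabelianGeometry.AbsoluteAnabelian

open _root_.CategoryTheory _root_.Quiver

universe u

namespace LFVertex

/-- Along an edge of `Γ⃗_𝒟` the row does not decrease (`log` and `id_⋎` stay in rows 1–2, all other
edges go down one row). [cite: MochizukiAbsTopIII2015, Corollary 3.6 p.78] -/
theorem row_le_of_hom : ∀ {a b : LFVertex}, (a ⟶ b) → a.row ≤ b.row := by
  intro a b e
  cases a <;> cases b <;> first | exact (PEmpty.elim e) | (simp only [LFVertex.row]; omega)

/-- Along a path of `Γ⃗_𝒟` the row does not decrease. [cite: MochizukiAbsTopIII2015, Corollary 3.6 p.78] -/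
theorem row_le_of_path {a b : LFVertex} (P : Path a b) : a.row ≤ b.row := by
  induction P with
  | nil => exact le_rfl
  | cons _ e ih => exact ih.trans (row_le_of_hom e)

end LFVertex

namespace LogFrobeniusData

open DiagramOfCategories

/-- The vertex of `𝒟_{≤3}` (presentation `𝒟_{≤2} ∪ {𝒩}`) over a vertex of `𝒟` of row `≤ 3`.
[cite: MochizukiAbsTopIII2015, Corollary 3.6 (iii) p.80] -/
def liftLogVertex : ∀ (v : LFVertex), v.row ≤ 3 → logObsShape.{u}.Vertex
  | .row1 n, _ => lvRow1 n
  | .nexus, _ => lvNexus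
  | .third, _ => lvObs
  | .fourth, h => absurd h (by decide)
  | .fifth, h => absurd h (by decide)
  | .sixth, h => absurd h (by decide)

/-- `embLog` is left inverse to the lift on vertices. [cite: MochizukiAbsTopIII2015, Corollary 3.6 (iii) p.80] -/
@[simp] theorem embLog_obj_liftLogVertex : ∀ (v : LFVertex) (h : v.row ≤ 3),
    embLog.obj (liftLogVertex.{u} v h) = v
  | .row1 _, _ => rfl
  | .nexus, _ => rfl
  | .third, _ => rfl
  | .fourth, h => absurd h (by decide)
  | .fifth, h => absurd h (by decide)
  | .sixth, h => absurd h (by decide)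

/-- The lift is left inverse to `embLog` on vertices. [cite: MochizukiAbsTopIII2015, Corollary 3.6 (iii) p.80] -/
@[simp] theorem liftLogVertex_embLog_obj : ∀ (a : logObsShape.{u}.Vertex) (h : (embLog.obj a).row ≤ 3),
    liftLogVertex (embLog.obj a) h = a
  | ExtVertex.base ⟨.row1 _, _⟩, _ => rfl
  | ExtVertex.base ⟨.nexus, _⟩, _ => rfl
  | ExtVertex.base ⟨.third, hv⟩, _ => absurd (show (3 : ℕ) ≤ 2 from hv) (by decide)
  | ExtVertex.base ⟨.fourth, hv⟩, _ => absurd (show (4 : ℕ) ≤ 2 from hv) (by decide)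
  | ExtVertex.base ⟨.fifth, hv⟩, _ => absurd (show (5 : ℕ) ≤ 2 from hv) (by decide)
  | ExtVertex.base ⟨.sixth, hv⟩, _ => absurd (show (6 : ℕ) ≤ 2 from hv) (by decide)
  | ExtVertex.obs, _ => rfl

/-- The row of (the image of) a vertex of `𝒟_{≤3}` is at most `3`. [cite: MochizukiAbsTopIII2015, Corollary 3.6 (iii) p.80] -/
theorem row_embLog_obj_le : ∀ (a : logObsShape.{u}.Vertex), (embLog.obj a).row ≤ 3
  | ExtVertex.base ⟨v, hv⟩ => le_trans (show v.row ≤ 2 from hv) (by decide)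
  | ExtVertex.obs => le_rfl

/-- The edge of `𝒟_{≤3}` over an edge of `𝒟` ending in rows 1–3.
[cite: MochizukiAbsTopIII2015, Corollary 3.6 (iii) p.80] -/
def liftLogEdge : ∀ {a b : LFVertex} (e : a ⟶ b) (hb : b.row ≤ 3),
    (liftLogVertex.{u} a ((LFVertex.row_le_of_hom e).trans hb) ⟶ liftLogVertex.{u} b hb) := by
  intro a b e hb
  cases a <;> cases b <;>
    first
      | exact (PEmpty.elim e)
      | exact e
      | exact absurd hb (by decide)

/-- The path of `𝒟_{≤3}` over a path of `𝒟` ending in rows 1–3 (lift edge by edge; the source lies in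
rows 1–3 by `row_le_of_path`). [cite: MochizukiAbsTopIII2015, Corollary 3.6 (iii) p.80] -/
def liftLogPath : ∀ {a b : LFVertex} (P : Path a b) (hb : b.row ≤ 3),
    Path (liftLogVertex.{u} a ((LFVertex.row_le_of_path P).trans hb)) (liftLogVertex.{u} b hb)
  | _, _, .nil, _ => Path.nil
  | _, _, .cons P e, hb => (liftLogPath P ((LFVertex.row_le_of_hom e).trans hb)).cons (liftLogEdge e hb)

/-- `liftLogPath` of the empty path. [cite: MochizukiAbsTopIII2015, Corollary 3.6 (iii) p.80] -/
@[simp] theorem liftLogPath_nil (a : LFVertex) (h : a.row ≤ 3) :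
    liftLogPath.{u} (Path.nil : Path a a) h = Path.nil := by
  simp only [liftLogPath]

/-- `liftLogPath` of an extended path. [cite: MochizukiAbsTopIII2015, Corollary 3.6 (iii) p.80] -/
@[simp] theorem liftLogPath_cons {a b c : LFVertex} (P : Path a b) (e : b ⟶ c) (hc : c.row ≤ 3) :
    liftLogPath.{u} (P.cons e) hc =
      (liftLogPath P ((LFVertex.row_le_of_hom e).trans hc)).cons (liftLogEdge e hc) := by
  simp only [liftLogPath]

/-- `embLog ∘ lift = id` on paths (heterogeneously: the endpoints agree by `embLog_obj_liftLogVertex`).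
[cite: MochizukiAbsTopIII2015, Corollary 3.6 (iii) p.80] -/
theorem embLog_mapPath_liftLogPath {a : LFVertex} : ∀ {b : LFVertex} (P : Path a b) (hb : b.row ≤ 3),
    HEq (embLog.mapPath (liftLogPath.{u} P hb)) P := by
  intro b P
  induction P with
  | nil =>
    intro hb
    rw [liftLogPath_nil, Prefunctor.mapPath_nil]
    rcases a with _ | _ | _ | _ | _ | _ <;>
      first | exact HEq.rfl | exact absurd hb (by decide)
  | cons P e ih =>
    rename_i c b
    intro hb
    rw [liftLogPath_cons, Prefunctor.mapPath_cons]
    have ha : a.row ≤ 3 := (LFVertex.row_le_of_path P).trans ((LFVertex.row_le_of_hom e).trans hb)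
    have ih' := ih ((LFVertex.row_le_of_hom e).trans hb)
    revert ih' e hb
    rcases a with _ | _ | _ | _ | _ | _ <;>
      first
        | exact absurd ha (by decide)
        | (rcases c with _ | _ | _ | _ | _ | _ <;> rcases b with _ | _ | _ | _ | _ | _ <;> intro e hb <;>
            first
              | exact (PEmpty.elim e)
              | (intro ih'; exact heq_of_eq (by rw [eq_of_heq ih']; rfl))
              | exact absurd hb (by decide))

/-- `lift ∘ embLog = id` on paths. [cite: MochizukiAbsTopIII2015, Corollary 3.6 (iii) p.80] -/
theorem liftLogPath_mapPath {a : logObsShape.{u}.Vertex} :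
    ∀ {b : logObsShape.{u}.Vertex} (p : Path a b) (hb : (embLog.obj b).row ≤ 3),
      HEq (liftLogPath.{u} (embLog.mapPath p) hb) p := by
  intro b p
  induction p with
  | nil =>
    intro hb
    rw [Prefunctor.mapPath_nil, liftLogPath_nil]
    rcases a with ⟨_ | _ | _ | _ | _ | _, ha⟩ | _ <;>
      first
        | exact absurd (show (3 : ℕ) ≤ 2 from ha) (by decide)
        | exact absurd (show (4 : ℕ) ≤ 2 from ha) (by decide)
        | exact absurd (show (5 : ℕ) ≤ 2 from ha) (by decide)
        | exact absurd (show (6 : ℕ) ≤ 2 from ha) (by decide)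
        | exact HEq.rfl
  | cons p e ih =>
    rename_i c b
    intro hb
    rw [Prefunctor.mapPath_cons, liftLogPath_cons]
    have ih' := ih ((LFVertex.row_le_of_hom (embLog.map e)).trans hb)
    revert ih' e hb
    rcases a with ⟨_ | _ | _ | _ | _ | _, ha⟩ | _ <;>
      first
        | exact absurd (show (3 : ℕ) ≤ 2 from ha) (by decide)
        | exact absurd (show (4 : ℕ) ≤ 2 from ha) (by decide)
        | exact absurd (show (5 : ℕ) ≤ 2 from ha) (by decide)
        | exact absurd (show (6 : ℕ) ≤ 2 from ha) (by decide)
        | (rcases c with ⟨_ | _ | _ | _ | _ | _, hc⟩ | _ <;>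
            first
              | exact absurd (show (3 : ℕ) ≤ 2 from hc) (by decide)
              | exact absurd (show (4 : ℕ) ≤ 2 from hc) (by decide)
              | exact absurd (show (5 : ℕ) ≤ 2 from hc) (by decide)
              | exact absurd (show (6 : ℕ) ≤ 2 from hc) (by decide)
              | (rcases b with ⟨_ | _ | _ | _ | _ | _, hb'⟩ | _ <;> intro e hb <;>
                  first
                    | exact (PEmpty.elim e)
                    | exact absurd (show (3 : ℕ) ≤ 2 from hb') (by decide)
                    | (intro ih'; exact heq_of_eq (by rw [eq_of_heq ih']; rfl))))

end LogFrobeniusData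

end Literature.AnabelianGeometry.AbsoluteAnabelian
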